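import Literature.NumberTheory.EllipticCurves.ZpExtensionShapiroToEisensteinKolyvaginSystemProofs
import Literature.NumberTheory.EllipticCurves.ZpExtensionEisensteinBadPlacesLocalTorsionProofs
import Literature.NumberTheory.EllipticCurves.ZpExtensionShapiroDualityDatum
import Literature.NumberTheory.EllipticCurves.ZpExtensionEisensteinConjugationDatumProofs
import Literature.NumberTheory.EllipticCurves.ZpExtensionEisensteinH1Limit
import Literature.NumberTheory.EllipticCurves.MastellaZerman2026.HowardDivisibilityScalarImage
import Literature.NumberTheory.EllipticCurves.Isogeny
import Summits.BirchSwinnertonDyer.BirchSwinnertonDyer.Theorems.PrintX10bControlBottomClassNonvanishing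
import HarnessLib

/-!
# STUB A of the shared μ-crux `MuInequalityCoherentPairOfPrint` (stmt-BirchSwinnertonDyer-23237): the `ksLink`
# conjunct — CGLS's Heegner point Kolyvagin system pushed into Howard's Eisenstein DVR setting at `𝔮_m = (T^m + p)`,
# bottom class = the compact control image of the stabilised class, NON-ZERO, for every `m ≫ 0` (helper, theorems only)

Summits-side helper for the line `spec_witnesses` (skeleton v5, μ-LEAD `bsd-line-x9-p1` g4); `--supports`
stmt-BirchSwinnertonDyer-23237.  THEOREMS ONLY (no definition, no named fact, no `sorry`).

The registered stub `stub_howardInputs` of skeleton v5 CONSUMES the print leaf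
`CastellaGrossiLeeSkinner2022.thm411_exists_kolyvaginSystem_one_ne_zero` (CGLS 2022 Thm. 4.1.1 with Rem. 4.1.4, item
23236 by name) and is assembled by D1's `howardInputs_of_clauses` (x10b-p1 LEAD g8, evidence `D1StubAAssembly.lean` on
23237) from four inputs `poitouTate`, `h4AtS`, `h5bAtS`, `ksLink`.  This file discharges the fourth one from the leaf:

* `WeierstrassCurve.kolyvaginSystem_one_ne_zero_of_forall_eq_proj` — a family of classes whose level-`k` component is
  `proj_{k+1} h` for all `k` is non-zero as soon as `h ≠ 0` in the pinned `H¹(K, T_𝔮)` (joint injectivity `EisensteinH1Data.ext`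
  + the reduction `proj_reduce` for level `0`);
* `WeierstrassCurve.ne_zero_of_thm411` — under CGLS Thm. 4.1.1 the stabilised class `z = κ_∞` is non-zero (its Shapiro image
  generates the same line as `κ₁^{Hg} ≠ 0`);
* **`WeierstrassCurve.exists_ksLink_of_thm411`** — for `m ≫ 0` (threshold chosen BEFORE `m` from the (N1) local torsion
  bound `exists_forall_mem_placesDividing_pow_smul_galoisCohomology_eq_zero` and the non-vanishing constants of
  `PrintX10bCompactControl.exists_forall_toEisensteinH1Linear_ne_zero`), with `S = {v ∣ pN}`, `𝓛 = 𝓛_E`, the tower pin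
  `t = (p ·)`, the limit pin `I = eisensteinH1Limit`, ANY tame pins and, for EVERY target conjugation datum / H.4 data / `SatisfiesH`
  witness: a Kolyvagin system on D1's `eisensteinDVRSettingLevelsTame` whose bottom class is `proj_{k+1} (f_m z)` at every level
  and is non-zero (`exists_eisensteinKolyvaginSystem_one_eq_proj` of x9-p2 g4 ∘ the source H.4 datum `shapiroDualityDataUnitTwist`
  at the canonical conjugation datum `ofLifts` ∘ C8);
* **`ksLink_of_thm411`** — the letter `Stmt.ksLink` of D1's assembly VERBATIM (with `ctrlLevel` unfolded), from the leaf.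

HONEST FRAMING: the `SatisfiesH` witness `hy` (H.0–H.5 of the Eisenstein setting; D1 lineage, inputs `h4AtS`/`h5bAtS` open at
`v ∣ p`) and the m-UNIFORM control (`stub_controlGlue`) are NOT touched here; no summit statement is proved; the μ-crux is not
asserted; BSD is not proved by any of this.

References: [CastellaGrossiLeeSkinner2022] Thm. 4.1.1, Rem. 4.1.4, §3.2 (𝓛_E), §3.4 (Σ = {w ∣ pN∞});
[Howard2004HeegnerKolyvagin] Rem. 1.2.4, §1.6, §2.2 Def. 2.2.3, Lemma 2.2.9, proof of Thm. 2.2.10 (arXiv:1202.6340 p. 17).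
-/

set_option linter.dupNamespace false
set_option autoImplicit false

noncomputable section

open scoped TensorProduct ContRepresentation Classical NumberField

namespace WeierstrassCurve

open Field IsDedekindDomain
open Literature.NumberTheory.EllipticCurves Literature.NumberTheory.GaloisRepresentations
open Literature.NumberTheory.GaloisRepresentations.DiscreteGaloisModule
open Literature.NumberTheory.GaloisCohomology.Howard2004
open Literature.NumberTheory.EllipticCurves.ZpExtension
open Literature.NumberTheory.EllipticCurves.CastellaGrossiLeeSkinner2022
open Summit.BirchSwinnertonDyer.BirchSwinnertonDyer.Theorems

variable {K : Type} [Field K] [NumberField K] {p : ℕ} [hp : Fact p.Prime]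

/-! ## §1 Non-vanishing of a family pinned to a non-zero element of `H¹(K, T_𝔮)` -/

omit [NumberField K] in
/-- **A family of classes `(x_k)_k` with `x_k = proj_{k+1} h` for all `k` is non-zero when `h ≠ 0`** in a pinned
`H¹(K, T_𝔮)` (`EisensteinH1Data`): if every `x_k` vanished, all projections `proj_{k+1} h` would vanish, hence also
`proj_0 h = H¹(red) (proj_1 h)` (`proj_reduce`), so `h = 0` by joint injectivity (`ext`).
[cite: Howard2004HeegnerKolyvagin, §2.2 Def. 2.2.3 (H¹(K, T_𝔮) = lim_k H¹(K, T_𝔮/p^k))] -/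
theorem kolyvaginSystem_one_ne_zero_of_forall_eq_proj {κ : ZpExtension K p}
    {M : ℕ → Type} [∀ k, AddCommGroup (M k)] [∀ k, TopologicalSpace (M k)] [∀ k, DiscreteTopology (M k)]
    {ρ : ∀ k, DiscreteGaloisModule K (M k)}
    {t : ∀ k, (ρ (k + 1)).toContRepresentation →ⁱL (ρ k).toContRepresentation} {m : ℕ} {hm : 1 ≤ m}
    (I : ZpExtension.EisensteinH1Data κ ρ t hm) {h : I.H} (hh : h ≠ 0)
    (x : ∀ k, galoisCohomology (κ.eisensteinTwist (ρ (k + 1)) hm (k + 1)) 1)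
    (hx : ∀ k, x k = I.proj (k + 1) h) : x ≠ 0 := by
  intro h0
  apply hh
  refine I.ext _ fun k ↦ ?_
  have h1 : ∀ k, I.proj (k + 1) h = 0 := fun k ↦ (hx k).symm.trans (congrFun h0 k)
  cases k with
  | zero => rw [← I.proj_reduce 0, h1 0, map_zero]
  | succ k => exact h1 k

/-! ## §2 The stabilised class is non-zero under CGLS Thm. 4.1.1 -/

section CGLS

variable {N : ℕ} [NeZero N] (W : WeierstrassCurve ℚ) [W.IsElliptic] [W.IsGloballyMinimal]
  (κ : ZpExtension K p) {γ : absoluteGaloisGroup K}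

set_option synthInstance.maxHeartbeats 80000 in
/-- **`z = κ_∞ ≠ 0` under CGLS Thm. 4.1.1** (by name, `h411`): the fact yields, for every choice of the presentation slots
(here: any tame pins `π`, any conjugation datum `cd` with source H.4 data `Dsrc`, the zero residual presentation), a Kolyvagin
system `κ` on `(𝐓, 𝓕_Λ, 𝓛_E)` with `κ.one = Φ′(z)` and `κ.one ≠ 0` (`exists_kolyvaginSystem_one_eq`); `Φ′` is additive, so
`z ≠ 0`. [cite: CastellaGrossiLeeSkinner2022, Thm. 4.1.1 and Rem. 4.1.4, last sentence] -/
theorem ne_zero_of_thm411 (h411 : thm411_exists_kolyvaginSystem_one_ne_zero)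
    (hyp : Thm413Hypotheses N W K p κ γ) (jbar : AlgebraicClosure K →+* ℂ)
    (D : (W.baseChange K).LambdaAdicSelmerData κ γ) (C : StabilizedHeegnerData N W K κ jbar) (z : D.S)
    (hz : ∀ (k : ℕ) (hk : C.depth < k), D.proj k z ∈ stabilizedClassLayer C k hk)
    (π : ∀ v : HeightOneSpectrum (𝓞 K), TamePin v) (cd : ConjugationDatum K)
    (Dsrc : ∀ j, DualityDatum p cd ((W.shapiroTower K p (κ.unitTwist (-1))).ρ j) (IwasawaAlgebra p ⧸ shapiroIdeal p (j + 1))) :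
    z ≠ 0 := by
  letI := W.shapiroResidueModule K p
  obtain ⟨κsrc, hone, hne⟩ := CastellaGrossiLeeSkinner2022.exists_kolyvaginSystem_one_eq h411 hyp D C z hz π
    (fun n v ↦ n ∈ levels (heegnerKolyvaginPrimes W (κ.unitTwist (-1)) (placesDividing K (p * N) mul_level_ne_zero)) ∧ v ∈ n)
    (W.shapiroTameHyp_of_mem_levels (κ.unitTwist (-1)) (placesDividing K (p * N) mul_level_ne_zero)
      (fun _ hv ↦ mem_placesDividing_of_dvd mul_level_ne_zero (dvd_mul_right p N) hv)
      (fun _ hv _ ↦ hasGoodReductionAt_of_not_mem_placesDividing W hyp.level mul_level_ne_zero hv)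
      (heegnerKolyvaginPrimes W (κ.unitTwist (-1)) (placesDividing K (p * N) mul_level_ne_zero))
      (heegnerKolyvaginPrimes_subset_degreeTwoPrimes W (κ.unitTwist (-1)) _)
      (fun _ hv ↦ not_mem_of_mem_heegnerKolyvaginPrimes W (κ.unitTwist (-1)) _ hv))
    (fun n hn v hv ↦ ⟨hn, hv⟩) cd (fun _ ↦ 0) Dsrc
  rintro rfl
  exact hne (hone.trans (by rw [map_zero]; rfl))

/-! ## §3 The Kolyvagin system with the LINK, non-zero, for `m ≫ 0` -/

set_option synthInstance.maxHeartbeats 80000 in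
/-- **The `ksLink` conjunct of STUB A from CGLS Thm. 4.1.1** (minimal hypotheses).  Under the §3.2/§4.1 standing hypotheses
(`Thm413Hypotheses`), for the stabilised class `z = κ_∞ ∈ 𝔖` (`hz`) generating a line of finite index (`hcyc`, `htor`, `𝔖`
finitely generated): there is `m₁` such that for every `m ≥ m₁` (`m ≥ 1`), with `S = {v ∣ pN}` (⊇ places above `p`, good
reduction outside, every `v ∈ S` above `p` or `N`, `Aut(K/ℚ)`-stable), ANY tame pins `π`, `𝓛 = 𝓛_E` (inside `𝓛₀(T_𝔮)`, off
`S`, containing `𝓛₁(T_𝔮) ∖ S`), the tower pin `t_k = (p ·)` and the limit pin `I = eisensteinH1Limit`, and for EVERY target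
conjugation datum `cd`, H.4 data `Dd` and `SatisfiesH` witness `hy`: a Kolyvagin system `κ′` on Howard's Eisenstein DVR setting
`(T_𝔮, F_𝔮, 𝓛_E)` of `E_K` at `𝔮 = (T^m + p)` (D1's `eisensteinDVRSettingLevelsTame` on `κ⁻ = κ.unitTwist (-1)`) with
`κ′.one ≠ 0` and `κ′.one k = proj_{k+1} (f_m z)` for all `k`, `f_m = toEisensteinH1Linear` the compact control map.
Proof: `exists_eisensteinKolyvaginSystem_one_eq_proj` (the pushforward of the CGLS system along THE `Hom`, x9-p2 g4) fed with
the (N1) local torsion bound at the places of `S` prime to `p` (valid for `m > m₁′`), the source H.4 datum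
`shapiroDualityDataUnitTwist` at the canonical conjugation datum `ofLifts σ … (e c₀ e⁻¹) …`; non-vanishing by §1 from
`PrintX10bCompactControl.exists_forall_toEisensteinH1Linear_ne_zero` (valid for `m ≥ p^{n₁}, m₂`) and `z ≠ 0` (§2).
[cite: CastellaGrossiLeeSkinner2022, Thm. 4.1.1, Rem. 4.1.4, §3.2, §3.4] [cite: Howard2004HeegnerKolyvagin, Rem. 1.2.4, §1.6, Lemma 2.2.9 and proof of Thm. 2.2.10 (arXiv p. 17)] -/
theorem exists_ksLink_of_thm411 (h411 : thm411_exists_kolyvaginSystem_one_ne_zero)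
    (hyp : Thm413Hypotheses N W K p κ γ) (jbar : AlgebraicClosure K →+* ℂ)
    (D : (W.baseChange K).LambdaAdicSelmerData κ γ) (C : StabilizedHeegnerData N W K κ jbar) (z : D.S)
    (hz : ∀ (k : ℕ) (hk : C.depth < k), D.proj k z ∈ stabilizedClassLayer C k hk)
    (hcyc : stabilizedHeegnerModule D C = Submodule.span (IwasawaAlgebra p) {z})
    (hfinS : Module.Finite (IwasawaAlgebra p) D.S)
    (htor : Module.IsTorsion (IwasawaAlgebra p) (D.S ⧸ stabilizedHeegnerModule D C)) :
    ∃ m₁ : ℕ, ∀ (m : ℕ) (hm : 1 ≤ m), m₁ ≤ m →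
      letI := IwasawaAlgebra.isDomain_quotient_X_pow_add_C p hm
      letI := IwasawaAlgebra.isDiscreteValuationRing_quotient_X_pow_add_C p hm
      haveI := IwasawaAlgebra.EisensteinCoeff.isLocalRing_succ p hm
      letI := IwasawaAlgebra.EisensteinCoeff.algebraOfSpecSucc p m
      haveI := W.isScalarTower_algebraOfSpecSucc (K := K) (p := p) (m := m)
      letI := W.residueModuleSucc (K := K) (p := p) hm
      ∀ (π : ∀ v : HeightOneSpectrum (𝓞 K), TamePin v) (cd : ConjugationDatum K)
        (Dd : ∀ k, DualityDatum p cd ((W.eisensteinTower (κ.unitTwist (-1)) hm).ρ k)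
          (IwasawaAlgebra.EisensteinCoeff p m (k + 1)))
        (hy : (W.eisensteinDVRSettingLevelsTame (κ.unitTwist (-1)) hm π
          (placesDividing K (p * N) mul_level_ne_zero)
          (fun _ hv ↦ mem_placesDividing_of_dvd mul_level_ne_zero (dvd_mul_right p N) hv)
          (fun _ hv _ ↦ hasGoodReductionAt_of_not_mem_placesDividing W hyp.level mul_level_ne_zero hv)
          (heegnerKolyvaginPrimes W (κ.unitTwist (-1)) (placesDividing K (p * N) mul_level_ne_zero))
          (W.heegnerKolyvaginPrimes_subset_degreeTwoPrimes_eisensteinTower (κ.unitTwist (-1)) hm (κ.unitTwist (-1))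
            (placesDividing K (p * N) mul_level_ne_zero)
            (fun _ hv _ ↦ hasGoodReductionAt_of_not_mem_placesDividing W hyp.level mul_level_ne_zero hv))
          (fun _ hv ↦ not_mem_of_mem_heegnerKolyvaginPrimes W (κ.unitTwist (-1)) _ hv) jbar cd Dd).SatisfiesH),
        ∃ κKS : (W.eisensteinDVRSettingLevelsTame (κ.unitTwist (-1)) hm π
          (placesDividing K (p * N) mul_level_ne_zero)
          (fun _ hv ↦ mem_placesDividing_of_dvd mul_level_ne_zero (dvd_mul_right p N) hv)
          (fun _ hv _ ↦ hasGoodReductionAt_of_not_mem_placesDividing W hyp.level mul_level_ne_zero hv)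
          (heegnerKolyvaginPrimes W (κ.unitTwist (-1)) (placesDividing K (p * N) mul_level_ne_zero))
          (W.heegnerKolyvaginPrimes_subset_degreeTwoPrimes_eisensteinTower (κ.unitTwist (-1)) hm (κ.unitTwist (-1))
            (placesDividing K (p * N) mul_level_ne_zero)
            (fun _ hv _ ↦ hasGoodReductionAt_of_not_mem_placesDividing W hyp.level mul_level_ne_zero hv))
          (fun _ hv ↦ not_mem_of_mem_heegnerKolyvaginPrimes W (κ.unitTwist (-1)) _ hv) jbar cd Dd).KolyvaginSystem,
          κKS.one ≠ 0 ∧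
          ∀ k, κKS.one k = ((κ.unitTwist (-1)).eisensteinH1Limit
              (fun k ↦ (W.baseChange K).torsionGaloisModule ((p : ℤ) ^ k))
              (fun j ↦ (W.baseChange K).torsionGaloisModuleReduce p j) hm).proj (k + 1)
            (D.toEisensteinH1Linear hm (fun j ↦ (W.baseChange K).torsionGaloisModuleReduce p j) (fun _ _ ↦ rfl)
              ((κ.unitTwist (-1)).eisensteinH1Limit (fun k ↦ (W.baseChange K).torsionGaloisModule ((p : ℤ) ^ k))
                (fun j ↦ (W.baseChange K).torsionGaloisModuleReduce p j) hm)
              hyp.topGenerator hyp.noPTorsion z) := by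
  haveI := hfinS
  have hK : IsImaginaryQuadratic K := hyp.isImaginaryQuadratic
  haveI : NumberField.IsTotallyComplex K := hK.isTotallyComplex
  have himag : ∀ w : NumberField.InfinitePlace K, w.IsComplex := fun w ↦ NumberField.IsTotallyComplex.isComplex w
  -- the canonical conjugation datum of the SOURCE and its H.4 data
  obtain ⟨c₀, hc₀⟩ := exists_isComplexConjugation (Rat.castHom ℝ)
  obtain ⟨σ, hσ₁, hσ, hτl, hτ₂, -, hτ⟩ := exists_conjugationDatum_ofLifts_τ_eq_absGaloisTransport hK hc₀
  have hπ0 : ∀ v : HeightOneSpectrum (𝓞 K), Nonempty (TamePin v) := nonempty_tamePin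
  -- `z ≠ 0` (CGLS) and the torsion hypothesis on the line `Λ z`
  have hz0 : z ≠ 0 := W.ne_zero_of_thm411 κ h411 hyp jbar D C z hz (fun v ↦ (hπ0 v).some)
    (ConjugationDatum.ofLifts σ hσ₁ hσ _ hτl hτ₂)
    (W.shapiroDualityDataUnitTwist _ κ (-1) hyp.anticyclotomic himag hc₀ hτ)
  have htor' : Module.IsTorsion (IwasawaAlgebra p) (D.S ⧸ Submodule.span (IwasawaAlgebra p) {z}) := hcyc ▸ htor
  -- the two thresholds
  obtain ⟨n₁, m₂, hC8⟩ := PrintX10bCompactControl.exists_forall_toEisensteinH1Linear_ne_zero D hyp.topGenerator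
    hyp.noPTorsion z hz0 htor'
  obtain ⟨m₁, hN1⟩ := (W.baseChange K).exists_forall_mem_placesDividing_pow_smul_galoisCohomology_eq_zero
    (κ.unitTwist (-1)) hK (hyp.anticyclotomic.unitTwist (-1)) hyp.heegner (mul_level_ne_zero (p := p) (N := N))
  refine ⟨max (m₁ + 1) (max (p ^ n₁) m₂), fun m hm hle π cd Dd hy ↦ ?_⟩
  have hm1 : m₁ < m := Nat.lt_of_lt_of_le (Nat.lt_succ_self _) ((le_max_left _ _).trans hle)
  have hmn : p ^ n₁ ≤ m := ((le_max_left _ _).trans (le_max_right _ _)).trans hle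
  have hm2 : m₂ ≤ m := ((le_max_right _ _).trans (le_max_right _ _)).trans hle
  letI := IwasawaAlgebra.isDomain_quotient_X_pow_add_C p hm
  letI := IwasawaAlgebra.isDiscreteValuationRing_quotient_X_pow_add_C p hm
  haveI := IwasawaAlgebra.EisensteinCoeff.isLocalRing_succ p hm
  letI := IwasawaAlgebra.EisensteinCoeff.algebraOfSpecSucc p m
  haveI := W.isScalarTower_algebraOfSpecSucc (K := K) (p := p) (m := m)
  letI := W.residueModuleSucc (K := K) (p := p) hm
  letI := W.shapiroResidueModule K p
  obtain ⟨κKS, hlink⟩ := W.exists_eisensteinKolyvaginSystem_one_eq_proj κ hm π h411 hyp jbar D C z hz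
    (ConjugationDatum.ofLifts σ hσ₁ hσ _ hτl hτ₂) (fun _ ↦ 0)
    (W.shapiroDualityDataUnitTwist _ κ (-1) hyp.anticyclotomic himag hc₀ hτ) cd Dd
    ((κ.unitTwist (-1)).eisensteinH1Limit (fun k ↦ (W.baseChange K).torsionGaloisModule ((p : ℤ) ^ k))
      (fun j ↦ (W.baseChange K).torsionGaloisModuleReduce p j) hm)
    (fun v hv hpv ↦ hN1 m hm hm1 v hv hpv) hy
  exact ⟨κKS, kolyvaginSystem_one_ne_zero_of_forall_eq_proj _ (hC8 hm _ (fun _ _ ↦ rfl) _ hmn hm2) _ hlink, hlink⟩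

end CGLS

end WeierstrassCurve

/-! ## §4 The letter `Stmt.ksLink` of the D1 assembly, verbatim, from the leaf -/

namespace Summit.BirchSwinnertonDyer.BirchSwinnertonDyer.Theorems.HeegnerMuPartKSLink

open Field NumberField IsDedekindDomain
open Literature Literature.NumberTheory.EllipticCurves WeierstrassCurve
open Literature.NumberTheory.GaloisCohomology Literature.NumberTheory.GaloisCohomology.Howard2004
open Literature.NumberTheory.GaloisRepresentations Literature.NumberTheory.GaloisRepresentations.DiscreteGaloisModule
open Literature.NumberTheory.EllipticCurves.ZpExtension

set_option synthInstance.maxHeartbeats 80000 in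
/-- **INPUT 4 (`Stmt.ksLink`) of D1's `howardInputs_of_clauses`, GIVEN CGLS Thm. 4.1.1 by name** — the letter verbatim
(the same binder prefix as `Stmt.howardInputs` of skeleton v5; `ctrlLevel … z k` unfolded to
`I.proj (k+1) (D.toEisensteinH1Linear hm t ht I hγ hE z)`): the KS side chooses `S = {v ∣ pN}`, the threshold `m₁` of
`exists_ksLink_of_thm411`, the given tame pins, `𝓛 = 𝓛_E` with the `LargePrimes` witness `𝓛₁(T_𝔮) ∖ S ⊆ 𝓛_E` (`s₁ = 1`),
`t = (p ·)`, `ht = rfl`, `I = eisensteinH1Limit`, `jbar′ = jbar`.  So `stub_howardInputs hK = howardInputs_of_clauses hPT H4 H5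
(ksLink_of_thm411 hK)` once `h4AtS`/`h5bAtS` close (`hPT` is the kernel theorem
`InputsPoitouTateSelmer.poitouTate_selmerStructure_duality_conj_holds`).
[cite: CastellaGrossiLeeSkinner2022, Thm. 4.1.1, Rem. 4.1.4, §3.2, §3.4] [cite: Howard2004HeegnerKolyvagin, Rem. 1.2.4, §1.6, Thm. 1.6.1 (𝓛_s(T) ⊂ 𝓛), proof of Thm. 2.2.10] -/
theorem ksLink_of_thm411
    (h411 : Literature.NumberTheory.EllipticCurves.CastellaGrossiLeeSkinner2022.thm411_exists_kolyvaginSystem_one_ne_zero) :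
    ∀ (N : ℕ) [NeZero N] (W : WeierstrassCurve ℚ) [W.IsGloballyMinimal] (K : Type) [Field K] [NumberField K]
    (p : ℕ) [Fact p.Prime] (κ : ZpExtension K p) (γ : Field.absoluteGaloisGroup K)
    (jbar : AlgebraicClosure K →+* ℂ) (hyp : CastellaGrossiLeeSkinner2022.Thm413Hypotheses N W K p κ γ),
    ¬ W.HasCM → W.HasIrreducibleModPGaloisRep p → (W.baseChange K).HasIrreducibleModPGaloisRep p →
    MastellaZerman2026.HasPadicScalarImage W p → SatisfiesHeegnerHypothesis p K →
    p ∣ NumberField.classNumber K →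
    ∀ (D : (W.baseChange K).LambdaAdicSelmerData κ γ)
      (C : CastellaGrossiLeeSkinner2022.StabilizedHeegnerData N W K κ jbar)
      (X : (W.baseChange K).SelmerDualData κ γ) (z : D.S),
    (∀ (k : ℕ) (hk : C.depth < k), D.proj k z ∈ CastellaGrossiLeeSkinner2022.stabilizedClassLayer C k hk) →
    CastellaGrossiLeeSkinner2022.stabilizedHeegnerModule D C = Submodule.span (IwasawaAlgebra p) {z} →
    Module.Finite (IwasawaAlgebra p) D.S → Module.Finite (IwasawaAlgebra p) X.X →
    Module.IsTorsion (IwasawaAlgebra p) (D.S ⧸ CastellaGrossiLeeSkinner2022.stabilizedHeegnerModule D C) →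
    haveI := hyp.isElliptic
    ∃ (S : Finset (HeightOneSpectrum (𝓞 K)))
      (hpS : ∀ v, ((p : ℕ) : 𝓞 K) ∈ v.asIdeal → v ∈ S)
      (hbad : ∀ v, v ∉ S → ((p : ℕ) : 𝓞 K) ∉ v.asIdeal → (W.baseChange K).HasGoodReductionAt v)
      (_hSN : ∀ v ∈ S, ((p : ℕ) : 𝓞 K) ∈ v.asIdeal ∨ ((N : ℕ) : 𝓞 K) ∈ v.asIdeal)
      (_hSσ : ∀ (σ : K ≃ₐ[ℚ] K) (v : HeightOneSpectrum (𝓞 K)), σ • v ∈ S → v ∈ S)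
      (m₁ : ℕ), ∀ (m : ℕ) (hm : 1 ≤ m), m₁ ≤ m →
      letI := IwasawaAlgebra.isDomain_quotient_X_pow_add_C p hm
      letI := IwasawaAlgebra.isDiscreteValuationRing_quotient_X_pow_add_C p hm
      haveI := IwasawaAlgebra.EisensteinCoeff.isLocalRing_succ p hm
      letI := IwasawaAlgebra.EisensteinCoeff.algebraOfSpecSucc p m
      haveI := W.isScalarTower_algebraOfSpecSucc (K := K) (p := p) (m := m)
      letI := W.residueModuleSucc (K := K) (p := p) hm
      ∃ (π : ∀ v : HeightOneSpectrum (𝓞 K), TamePin v) (L : Set (HeightOneSpectrum (𝓞 K)))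
        (hL : L ⊆ (W.eisensteinTower (κ.unitTwist (-1)) hm).degreeTwoPrimes p) (hLS : ∀ v ∈ L, v ∉ S)
        (s₁ : ℕ) (_hsub : ∀ v ∈ (W.eisensteinTower (κ.unitTwist (-1)) hm).kolyvaginPrimes p s₁, v ∉ S → v ∈ L)
        (t : ∀ k, ((W.baseChange K).torsionGaloisModule ((p : ℤ) ^ (k + 1))).toContRepresentation →ⁱL
          ((W.baseChange K).torsionGaloisModule ((p : ℤ) ^ k)).toContRepresentation)
        (ht : ∀ k (P : geomTorsion (W.baseChange K) ((p : ℤ) ^ (k + 1))),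
          t k P = (W.baseChange K).geomTorsionReduce p k P)
        (I : ZpExtension.EisensteinH1Data (κ.unitTwist (-1))
          (fun k ↦ (W.baseChange K).torsionGaloisModule ((p : ℤ) ^ k)) t hm)
        (jbar' : AlgebraicClosure K →+* ℂ),
        ∀ (cd : ConjugationDatum K)
          (Dd : ∀ k, DualityDatum p cd ((W.eisensteinTower (κ.unitTwist (-1)) hm).ρ k)
            (IwasawaAlgebra.EisensteinCoeff p m (k + 1)))
          (hy : (W.eisensteinDVRSettingLevelsTame (κ.unitTwist (-1)) hm π S hpS hbad L hL hLS jbar' cd Dd).SatisfiesH),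
          ∃ κKS : (W.eisensteinDVRSettingLevelsTame (κ.unitTwist (-1)) hm π S hpS hbad L hL hLS jbar' cd Dd).KolyvaginSystem,
            κKS.one ≠ 0 ∧
            ∀ k, κKS.one k = I.proj (k + 1) (D.toEisensteinH1Linear hm t ht I hyp.topGenerator hyp.noPTorsion z) := by
  intro N _ W _ K _ _ p _ κ γ jbar hyp _ _ _ _ _ _ D C X z hz hcyc hfinS _ htor
  haveI := hyp.isElliptic
  have hK : IsImaginaryQuadratic K := hyp.isImaginaryQuadratic
  have hπ0 : ∀ v : HeightOneSpectrum (𝓞 K), Nonempty (TamePin v) := nonempty_tamePin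
  obtain ⟨m₁, hKS⟩ := W.exists_ksLink_of_thm411 κ h411 hyp jbar D C z hz hcyc hfinS htor
  refine ⟨CastellaGrossiLeeSkinner2022.placesDividing K (p * N) CastellaGrossiLeeSkinner2022.mul_level_ne_zero,
    fun _ hv ↦ CastellaGrossiLeeSkinner2022.mem_placesDividing_of_dvd CastellaGrossiLeeSkinner2022.mul_level_ne_zero
      (dvd_mul_right p N) hv,
    fun _ hv _ ↦ CastellaGrossiLeeSkinner2022.hasGoodReductionAt_of_not_mem_placesDividing W hyp.level
      CastellaGrossiLeeSkinner2022.mul_level_ne_zero hv,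
    fun _ hv ↦ CastellaGrossiLeeSkinner2022.natCast_mem_or_natCast_mem_of_mem_placesDividing
      CastellaGrossiLeeSkinner2022.mul_level_ne_zero hv,
    fun σ v hv ↦ CastellaGrossiLeeSkinner2022.mem_placesDividing_of_smul_mem CastellaGrossiLeeSkinner2022.mul_level_ne_zero
      σ v hv,
    m₁, fun m hm hle ↦ ?_⟩
  letI := IwasawaAlgebra.isDomain_quotient_X_pow_add_C p hm
  letI := IwasawaAlgebra.isDiscreteValuationRing_quotient_X_pow_add_C p hm
  haveI := IwasawaAlgebra.EisensteinCoeff.isLocalRing_succ p hm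
  letI := IwasawaAlgebra.EisensteinCoeff.algebraOfSpecSucc p m
  haveI := W.isScalarTower_algebraOfSpecSucc (K := K) (p := p) (m := m)
  letI := W.residueModuleSucc (K := K) (p := p) hm
  refine ⟨fun v ↦ (hπ0 v).some,
    CastellaGrossiLeeSkinner2022.heegnerKolyvaginPrimes W (κ.unitTwist (-1))
      (CastellaGrossiLeeSkinner2022.placesDividing K (p * N) CastellaGrossiLeeSkinner2022.mul_level_ne_zero),
    W.heegnerKolyvaginPrimes_subset_degreeTwoPrimes_eisensteinTower (κ.unitTwist (-1)) hm (κ.unitTwist (-1))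
      (CastellaGrossiLeeSkinner2022.placesDividing K (p * N) CastellaGrossiLeeSkinner2022.mul_level_ne_zero)
      (fun _ hv _ ↦ CastellaGrossiLeeSkinner2022.hasGoodReductionAt_of_not_mem_placesDividing W hyp.level
        CastellaGrossiLeeSkinner2022.mul_level_ne_zero hv),
    fun _ hv ↦ CastellaGrossiLeeSkinner2022.not_mem_of_mem_heegnerKolyvaginPrimes W (κ.unitTwist (-1)) _ hv,
    1, W.kolyvaginPrimes_eisensteinTower_subset_heegnerKolyvaginPrimes (κ.unitTwist (-1)) hm hK
      (hyp.anticyclotomic.unitTwist (-1)) _ le_rfl,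
    fun j ↦ (W.baseChange K).torsionGaloisModuleReduce p j, fun _ _ ↦ rfl,
    (κ.unitTwist (-1)).eisensteinH1Limit (fun k ↦ (W.baseChange K).torsionGaloisModule ((p : ℤ) ^ k))
      (fun j ↦ (W.baseChange K).torsionGaloisModuleReduce p j) hm,
    jbar, fun cd Dd hy ↦ ?_⟩
  exact hKS m hm hle _ cd Dd hy

end Summit.BirchSwinnertonDyer.BirchSwinnertonDyer.Theorems.HeegnerMuPartKSLink

end
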